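import Summits.Ventures.PercRepro.S2MaxExtension
import Summits.Ventures.PercRepro.S2RankThreeCount

/-!
# PercRepro — S2: THE NULLITY LEVER AT CORANK `7` (p7, gen 14; sub-claim S2; the spread case of `(14, 7)`)

A top `6`-set `B` at corank `7` (`ρ(B) = 5`, `E ∖ B` spanning) has a complement of `p + 1` points and rank `p`: nullity `1`.
So for every `P ⊆ E` of nullity `k` the set `B` meets `P` in `≥ k − 1` points (**`nullity_lever_top_six`**: removing a point
lowers the nullity by at most one, and `P ∖ B ⊆ E ∖ B` has nullity `≤ 1`). With `P` of nullity `≥ 3` avoiding a triangle `T`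
the top `6`-sets through `T` are `T ∪ X` with `|X ∩ P| ≥ 2`: at most `C(|P|, 2) · (|E ∖ T| − |P|) + C(|P|, 3)` of them
(**`ncard_top_six_through_le_of_nullity_three`**; three distinct triangles avoiding `T` give such a `P` of `≤ 9` points:
`≤ 36 · 9 + 84 = 408` at `(14, 7)`). Axioms: standard.
-/

open scoped Matroid

namespace PercRepro

namespace S2

open Set

variable {α : Type}

/-- **A top `6`-set at corank `7` meets every set of nullity `k` in `≥ k − 1` points.** -/
theorem nullity_lever_top_six (M : Matroid α) [M.Finite] {p : ℕ} (hR : M.eRank = (p : ℕ∞))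
    (hn : M.E.ncard = p + 7) {B : Set α} (hBE : B ⊆ M.E) (hB6 : B.ncard = 6) (hBs : M.eRk (M.E \ B) = M.eRank)
    {P : Set α} (hP : P ⊆ M.E) {k : ℕ} (hPk : M.eRk P + k ≤ P.encard) : k ≤ (B ∩ P).ncard + 1 := by
  have hEfin := M.ground_finite
  have hBfin : B.Finite := hEfin.subset hBE
  have hPfin : P.Finite := hEfin.subset hP
  have hPB : P \ B ⊆ M.E \ B := Set.sdiff_subset_sdiff_left hP
  -- the ranks are finite
  obtain ⟨r, hr⟩ := ENat.ne_top_iff_exists.1 (eRk_ne_top_of_finite (M := M) hP)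
  obtain ⟨r', hr'⟩ := ENat.ne_top_iff_exists.1 (eRk_ne_top_of_finite (M := M) (hPB.trans Set.sdiff_subset))
  -- `ρ(E ∖ B) ≤ ρ(P ∖ B) + |(E ∖ B) ∖ (P ∖ B)|`, with `|(E ∖ B) ∖ (P ∖ B)| + |P ∖ B| = p + 1`
  have hc := Set.ncard_sdiff_add_ncard_of_subset hPB (hEfin.sdiff)
  rw [Set.ncard_sdiff hBE hBfin, hn, hB6, show p + 7 - 6 = p + 1 by omega] at hc
  have h1 := M.eRk_union_le_eRk_add_encard (P \ B) ((M.E \ B) \ (P \ B))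
  rw [Set.union_sdiff_cancel hPB, hBs, hR, ← hr', ← ((hEfin.sdiff).sdiff).cast_ncard_eq] at h1
  -- `ρ P ≤ ρ(P ∖ B) + |P ∩ B|`
  have h2 := M.eRk_union_le_eRk_add_encard (P \ B) (P ∩ B)
  rw [Set.sdiff_union_inter, ← hr, ← hr', ← (hPfin.subset Set.inter_subset_left).cast_ncard_eq] at h2
  -- `ρ P + k ≤ |P| = |P ∖ B| + |P ∩ B|`
  rw [← hr, ← hPfin.cast_ncard_eq] at hPk
  have hsplit : P.ncard = (P \ B).ncard + (P ∩ B).ncard := by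
    rw [← Set.ncard_union_eq Set.disjoint_sdiff_inter (hPfin.subset Set.sdiff_subset)
      (hPfin.subset Set.inter_subset_left), Set.sdiff_union_inter]
  rw [Set.inter_comm]
  have h1' : p ≤ r' + ((M.E \ B) \ (P \ B)).ncard := by exact_mod_cast h1
  have h2' : r ≤ r' + (P ∩ B).ncard := by exact_mod_cast h2
  have h3 : r' ≤ r := by
    have : (r' : ℕ∞) ≤ r := by rw [hr, hr']; exact M.eRk_mono Set.sdiff_subset
    exact_mod_cast this
  have hPk' : r + k ≤ P.ncard := by exact_mod_cast hPk
  omega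

/-- **The `3`-subsets of `Z` meeting `P ⊆ Z` in `≥ 2` points**: at most `C(|P|, 2) · (|Z| − |P|) + C(|P|, 3)`. -/
theorem ncard_subsets_three_inter_ge_two_le (Z P : Set α) (hZ : Z.Finite) (hP : P ⊆ Z) :
    {X : Set α | X ⊆ Z ∧ X.ncard = 3 ∧ 2 ≤ (X ∩ P).ncard}.ncard ≤
      P.ncard.choose 2 * (Z.ncard - P.ncard) + P.ncard.choose 3 := by
  classical
  have hPfin : P.Finite := hZ.subset hP
  set Pairs := {Y : Set α | Y ⊆ P ∧ Y.ncard = 2} with hPairs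
  have hPairsfin : Pairs.Finite := hPfin.finite_subsets.subset (fun Y hY => hY.1)
  -- the sets with `X ∩ P = Y` for a pair `Y`, and the sets inside `P`
  have hcover : {X : Set α | X ⊆ Z ∧ X.ncard = 3 ∧ 2 ≤ (X ∩ P).ncard} ⊆
      (⋃ Y ∈ hPairsfin.toFinset, {X : Set α | X ⊆ Z ∧ X.ncard = 3 ∧ X ∩ P = Y}) ∪
        {X : Set α | X ⊆ P ∧ X.ncard = 3} := by
    rintro X ⟨hXZ, hX3, hXP⟩
    have hXfin : X.Finite := hZ.subset hXZ
    have hle : (X ∩ P).ncard ≤ 3 := by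
      have := Set.ncard_le_ncard (Set.inter_subset_left : X ∩ P ⊆ X) hXfin
      omega
    rcases (show (X ∩ P).ncard = 2 ∨ (X ∩ P).ncard = 3 by omega) with h2 | h3
    · refine Or.inl (Set.mem_iUnion₂.2 ⟨X ∩ P, ?_, hXZ, hX3, rfl⟩)
      rw [Set.Finite.mem_toFinset]
      exact ⟨Set.inter_subset_right, h2⟩
    · have hXsub : X ⊆ P := by
        have := Set.eq_of_subset_of_ncard_le Set.inter_subset_left (by rw [hX3, h3]) hXfin
        rw [← this]
        exact Set.inter_subset_right
      exact Or.inr ⟨hXsub, hX3⟩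
  -- each pair `Y` extends by one point of `Z ∖ P`
  have hfib : ∀ Y ∈ hPairsfin.toFinset,
      {X : Set α | X ⊆ Z ∧ X.ncard = 3 ∧ X ∩ P = Y}.ncard ≤ (Z \ P).ncard.choose 1 := by
    intro Y hY
    rw [Set.Finite.mem_toFinset] at hY
    have hYfin : Y.Finite := hPfin.subset hY.1
    rw [← ncard_subsets_ncard_eq (Z \ P) hZ.sdiff 1]
    refine Set.ncard_le_ncard_of_injOn (fun X => X \ P) ?_ ?_ (hZ.sdiff.finite_subsets.subset (fun W hW => hW.1))
    · rintro X ⟨hXZ, hX3, hXY⟩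
      refine ⟨Set.sdiff_subset_sdiff_left hXZ, ?_⟩
      have hXfin : X.Finite := hZ.subset hXZ
      have := Set.ncard_inter_add_ncard_sdiff_eq_ncard X P hXfin
      rw [hXY, hY.2, hX3] at this
      omega
    · rintro X₁ ⟨-, -, h₁⟩ X₂ ⟨-, -, h₂⟩ hEq
      simp only at hEq
      calc X₁ = (X₁ \ P) ∪ (X₁ ∩ P) := (Set.sdiff_union_inter X₁ P).symm
        _ = (X₂ \ P) ∪ (X₂ ∩ P) := by rw [hEq, h₁, h₂]
        _ = X₂ := Set.sdiff_union_inter X₂ P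
  have hUfin : (⋃ Y ∈ hPairsfin.toFinset, {X : Set α | X ⊆ Z ∧ X.ncard = 3 ∧ X ∩ P = Y}).Finite :=
    hZ.finite_subsets.subset (fun X hX => by
      obtain ⟨Y, -, hX⟩ := Set.mem_iUnion₂.1 hX
      exact hX.1)
  have hle := Set.ncard_le_ncard hcover (hUfin.union (hPfin.finite_subsets.subset (fun X hX => hX.1)))
  have hu := Set.ncard_union_le (⋃ Y ∈ hPairsfin.toFinset, {X : Set α | X ⊆ Z ∧ X.ncard = 3 ∧ X ∩ P = Y})
    {X : Set α | X ⊆ P ∧ X.ncard = 3}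
  have hsum : (⋃ Y ∈ hPairsfin.toFinset, {X : Set α | X ⊆ Z ∧ X.ncard = 3 ∧ X ∩ P = Y}).ncard ≤
      P.ncard.choose 2 * (Z.ncard - P.ncard) := by
    refine (Finset.set_ncard_biUnion_le hPairsfin.toFinset _).trans ?_
    calc ∑ Y ∈ hPairsfin.toFinset, {X : Set α | X ⊆ Z ∧ X.ncard = 3 ∧ X ∩ P = Y}.ncard
        ≤ ∑ _Y ∈ hPairsfin.toFinset, (Z \ P).ncard.choose 1 := Finset.sum_le_sum hfib
      _ = P.ncard.choose 2 * (Z.ncard - P.ncard) := by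
        rw [Finset.sum_const, smul_eq_mul, ← Set.ncard_eq_toFinset_card _ hPairsfin, hPairs,
          ncard_subsets_ncard_eq P hPfin 2, Nat.choose_one_right, Set.ncard_sdiff hP hPfin]
  rw [ncard_subsets_ncard_eq P hPfin 3] at hu
  omega

/-- **The top `6`-sets through a triangle against a set of nullity `≥ 3` avoiding it** (corank `7`). -/
theorem ncard_top_six_through_le_of_nullity_three (M : Matroid α) [M.Finite] {p : ℕ} (hR : M.eRank = (p : ℕ∞))
    (hn : M.E.ncard = p + 7) {T P : Set α} (hT : T ⊆ M.E) (hT3 : T.ncard = 3) (hP : P ⊆ M.E \ T)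
    (hP3 : M.eRk P + 3 ≤ P.encard) :
    {B : Set α | B ⊆ M.E ∧ B.ncard = 6 ∧ T ⊆ B ∧ M.eRk (M.E \ B) = M.eRank}.ncard ≤
      P.ncard.choose 2 * ((M.E \ T).ncard - P.ncard) + P.ncard.choose 3 := by
  classical
  have hTfin : T.Finite := M.ground_finite.subset hT
  have hZfin : (M.E \ T).Finite := M.ground_finite.sdiff
  refine le_trans ?_ (ncard_subsets_three_inter_ge_two_le (M.E \ T) P hZfin hP)
  refine Set.ncard_le_ncard_of_injOn (fun B : Set α => B \ T) ?_ ?_ (hZfin.finite_subsets.subset (fun X hX => hX.1))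
  · rintro B ⟨hBE, hB6, hTB, hBs⟩
    refine ⟨sdiff_subset_sdiff_left hBE, ?_, ?_⟩
    · rw [Set.ncard_sdiff hTB hTfin, hB6, hT3]
    · have h := nullity_lever_top_six M hR hn hBE hB6 hBs (hP.trans Set.sdiff_subset) hP3
      have heq : (B \ T) ∩ P = B ∩ P := by
        ext x
        simp only [Set.mem_inter_iff, Set.mem_sdiff]
        constructor
        · rintro ⟨⟨hxB, -⟩, hxP⟩; exact ⟨hxB, hxP⟩
        · rintro ⟨hxB, hxP⟩; exact ⟨⟨hxB, (hP hxP).2⟩, hxP⟩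
      rw [heq]
      have h' : 3 ≤ (B ∩ P).ncard + 1 := by exact_mod_cast h
      omega
  · rintro B₁ ⟨-, -, hT₁, -⟩ B₂ ⟨-, -, hT₂, -⟩ hEq
    simp only at hEq
    rw [← Set.sdiff_union_of_subset hT₁, ← Set.sdiff_union_of_subset hT₂, hEq]

end S2

end PercRepro
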